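import Literature.Geometry.Lorentzian.EventHorizon
import Literature.Geometry.Lorentzian.AchronalBoundary
import HarnessLib

/-!
# The area law for the intrinsic event horizon: bridges between `EventHorizon` and `EventHorizonArea`

Two renderings of the black-hole vocabulary of a Cauchy development entered the tree on
2026-08-15:

* `EventHorizon.lean` — the **absolute, intrinsic** notions of a data embedding / Cauchy
  development `𝒟 = (M, g, τ, ι, ν)`: `DataEmbedding.blackHoleRegion 𝒟 = (visibleRegion)ᶜ`
  (`M ∖ J⁻(𝓘⁺)` with the past of `𝓘⁺` rendered by future-complete normalised null rays,
  `VisibleIncompleteNullRay.lean`), `DataEmbedding.futureEventHorizon 𝒟 = ∂ visibleRegion`,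
  `DataEmbedding.completeNullRayRegion 𝒟` (the stand-in for `𝓘⁺`, with
  `I⁻(completeNullRayRegion) = visibleRegion`), the cuts `horizonCut` and their areas
  `horizonCutArea` (induced-metric form) / `cutArea`, `horizonSliceCutArea` (data-metric form);
* `EventHorizonArea.lean` — the notions **relative to a far region `U ⊆ M`**:
  `CauchyDevelopment.blackHoleRegion 𝒟 U = J⁺(ι X) ∖ I⁻(U)`,
  `CauchyDevelopment.eventHorizon 𝒟 U = ∂I⁻(U) ∩ J⁺(ι X)`, the advanced-time foliations
  `EventHorizonArea 𝒟 U` with `horizonArea`, and the **area theorem** of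
  Chruściel–Delay–Galloway–Howard (Ann. Henri Poincaré 2 (2001), Thm. 1.1 (b)) as the named fact
  `ChruscielEtAl2001_areaTheorem`, bridged to `Monotone A.horizonArea`.

This file proves that the two fit together at `U = 𝒟.completeNullRayRegion` and transports the
area theorem to the intrinsic horizon, discharging the hypotheses that are theorems for it:

* `CauchyDevelopment.eventHorizon_eq_eventHorizonOf` — the relative horizons of
  `EventHorizonArea.lean` and `RedShiftedHorizon.lean` coincide (definitionally);
  `CauchyDevelopment.eventHorizon_completeNullRayRegion` —
  `𝒟.eventHorizon 𝒟.completeNullRayRegion = 𝓗⁺ ∩ J⁺(ι X)`;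
  `CauchyDevelopment.blackHoleRegion_completeNullRayRegion` —
  `𝒟.blackHoleRegion 𝒟.completeNullRayRegion = 𝓑 ∩ J⁺(ι X)` (Hawking–Ellis' `ℬ` to the future of
  the data). *Dot-notation caveat:* for `𝒟 : CauchyDevelopment D` the spelling
  `𝒟.blackHoleRegion` denotes the two-argument relative notion of `EventHorizonArea.lean`; the
  absolute region is `𝒟.toDataEmbedding.blackHoleRegion` (they agree on `J⁺(ι X)` by the lemma
  just quoted); `𝒟.futureEventHorizon`, `𝒟.completeNullRayRegion`, `𝒟.horizonCutArea` are
  unambiguous.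
* `DataEmbedding.isSpacelikeImmersion_embed`, `DataEmbedding.inducedRiemannianMetric_embed`
  (`ι^* g = h` as Riemannian metrics, from `induced_h`) and `DataEmbedding.horizonCutArea_embed` —
  the induced-metric area of the cut by the data slice *is* the data-metric area
  `horizonSliceCutArea`, so the two area functionals of `EventHorizon.lean` agree where both apply.
* **The area law for `𝓗⁺`** from the named fact (hypothesis `hAT : ChruscielEtAl2001_areaTheorem`):
  `DataEmbedding.area_horizonCut_le` (leaves with metric data, as in the fact),
  `DataEmbedding.horizonCutArea_le` (leaves as spacelike immersions), and
  `EventHorizonArea.monotone_horizonArea_completeNullRayRegion` (advanced-time foliations of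
  `𝓗⁺ ∩ J⁺(ι X)`), in each of which **closedness and achronality of `𝓗⁺` are discharged**
  (`isClosed_frontier`, `DataEmbedding.isAchronal_futureEventHorizon`), leaving as hypotheses on
  `𝓗⁺` exactly the topological-hypersurface property, the ruling by future-complete null
  generators (CDGH hypothesis (b)) and the null energy condition on `𝓗⁺`; and the vacuum forms
  `VacuumCauchyDevelopment.horizonCutArea_le`,
  `VacuumCauchyDevelopment.monotone_horizonArea_completeNullRayRegion`, in which the null energy
  condition is discharged as well (`Ric = 0`).

* **With Hawking–Ellis' Prop. 6.3.1** (the named fact `HawkingEllis1973_achronalBoundary` of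
  `AchronalBoundary.lean`, hypothesis `h631`) the hypersurface hypothesis is discharged too:
  `𝓑 = 𝒟.blackHoleRegion` is a future set (`DataEmbedding.isFutureSet_blackHoleRegion`), so
  `𝓗⁺ = ∂𝓑` is an embedded topological `3`-submanifold
  (`DataEmbedding.isTopologicalSubmanifold_futureEventHorizon`); whence
  `DataEmbedding.horizonCutArea_le_of_achronalBoundary` and, for **vacuum** developments,
  `VacuumCauchyDevelopment.horizonCutArea_le_of_achronalBoundary` /
  `VacuumCauchyDevelopment.monotone_horizonArea_of_achronalBoundary`: *given the two named facts,
  the area of the cuts of the intrinsic event horizon of a vacuum Cauchy development is monotone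
  as soon as the generators of `𝓗⁺` are future complete* — Hawking's area theorem
  (Hawking–Ellis 1973, Prop. 9.2.7) in the differentiability-free form of
  Chruściel–Delay–Galloway–Howard, Thm. 1.1 (b), for the `𝓘⁺`-free horizon of the final-state
  routes, with the single remaining hypothesis being the physical one (complete generators, i.e.
  future asymptotic predictability in the intrinsic form).

Everything here is proved; no definition and no named fact is introduced (the two facts enter as
hypotheses `hAT`, `h631`).

## References

* P. T. Chruściel, E. Delay, G. J. Galloway, R. Howard, *Regularity of horizons and the area
  theorem*, Ann. Henri Poincaré 2 (2001) 109–178, arXiv:gr-qc/0001003, Thm. 1.1 (b), Thm. 6.1,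
  Prop. 4.17, §3 (3.9)–(3.11) (key `ChruscielEtAl2001`).
* S. W. Hawking, G. F. R. Ellis, *The Large Scale Structure of Space-Time*, CUP 1973, §9.2
  (p. 312: the event horizon is an achronal boundary; p. 315: `ℬ(τ) = 𝒮(τ) − J⁻(𝓘⁺)`;
  Prop. 9.2.7, the area theorem) (key `HawkingEllis1973`).
* R. M. Wald, *General Relativity*, Chicago 1984, §12.1–12.2 (key `Wald1984`).
* S. W. Hawking, G. F. R. Ellis, op. cit., §6.3, Prop. 6.3.1 (achronal boundaries; the named fact
  `HawkingEllis1973_achronalBoundary` of `AchronalBoundary.lean`).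
* B. O'Neill, *Semi-Riemannian geometry*, Academic Press 1983, Ch. 4, p. 97 (induced metric of a
  spacelike submanifold) (key `ONeill1983`).
-/

open Bundle Set MeasureTheory
open scoped Manifold ContDiff Topology ENNReal

noncomputable section

namespace Literature.Geometry.Lorentzian

universe u

/-! ### The data slice as a spacelike hypersurface -/

namespace DataEmbedding

variable {n : ℕ} {X : Type u} [TopologicalSpace X] [ChartedSpace (EuclideanSpace ℝ (Fin n)) X]
  [IsManifold (𝓡 n) ∞ X] [ConnectedSpace X] {D : InitialDataSet (𝓡 n) X}

/-- **The data embedding is a spacelike immersion**: `ι` is `C^∞` (a smooth embedding) and the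
induced form `ι^* g = h` (`induced_h`) is positive definite. O'Neill 1983, Ch. 4, p. 97 and
Ch. 5, p. 142. [cite: ONeill1983, Ch. 4, p. 97] -/
theorem isSpacelikeImmersion_embed (𝒟 : DataEmbedding D) :
    𝒟.metric.IsSpacelikeImmersion (𝓡 n) 𝒟.embed := by
  refine ⟨𝒟.isSmoothEmbedding.contMDiff.of_le (by norm_cast), fun y v hv ↦ ?_⟩
  show 0 < pullbackBilin (I := 𝓡 (n + 1)) (I' := 𝓡 n) 𝒟.embed 𝒟.metric.val y v v
  rw [𝒟.induced_h y]
  exact D.h.pos y v hv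

/-- **The metric induced on the data slice by the spacetime metric is the data metric**:
`ι^* g = h` as smooth Riemannian metrics on `TX` (the field `induced_h`, `∀ y, ι^* g (y) = h(y)`,
lifted to an equality of `ContMDiffRiemannianMetric` structures, whose remaining fields are
propositions). O'Neill 1983, Ch. 4, p. 97. [cite: ONeill1983, Ch. 4, p. 97] -/
theorem inducedRiemannianMetric_embed (𝒟 : DataEmbedding D)
    (hpb : PseudoRiemannianMetric.contMDiff_pullbackBilin (𝓡 (n + 1)) 𝒟.carrier (𝓡 n) X ∞) :
    𝒟.metric.inducedRiemannianMetric 𝒟.embed hpb 𝒟.isSpacelikeImmersion_embed = D.h := by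
  have hinner :
      (𝒟.metric.inducedRiemannianMetric 𝒟.embed hpb 𝒟.isSpacelikeImmersion_embed).inner =
        D.h.inner := by
    funext y
    exact 𝒟.induced_h y
  cases hD : D.h with
  | mk inner symm pos bdd cont =>
    rw [hD] at hinner
    simp only at hinner
    subst hinner
    rfl

/-- **The two area functionals of `EventHorizon.lean` agree on the data slice**: the area of the
cut of `𝓗⁺` by `ι : X → M`, computed in the induced metric `ι^* g` (`horizonCutArea`), equals the
area of `ι ⁻¹(𝓗⁺)` in the data metric `h` (`horizonSliceCutArea`). [folklore] -/
theorem horizonCutArea_embed (𝒟 : DataEmbedding D) [𝒟.metric.HasLeviCivita] [T3Space X]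
    [MeasurableSpace X] [BorelSpace X]
    (hpb : PseudoRiemannianMetric.contMDiff_pullbackBilin (𝓡 (n + 1)) 𝒟.carrier (𝓡 n) X ∞) :
    𝒟.horizonCutArea 𝒟.embed hpb 𝒟.isSpacelikeImmersion_embed = 𝒟.horizonSliceCutArea := by
  rw [horizonCutArea, LorentzianMetric.horizonCutArea, inducedRiemannianMetric_embed]
  rfl

/-- **The intrinsic black-hole region is a future set** (`I⁺(𝓑) ⊆ 𝓑`,
`chronologicalFuture_blackHoleRegion_subset` of `EventHorizon.lean`, in the vocabulary of
`AchronalBoundary.lean`). Hawking–Ellis 1973, §6.3, p. 186 and §9.2. [cite: HawkingEllis1973, §6.3, p. 186] -/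
theorem isFutureSet_blackHoleRegion (𝒟 : DataEmbedding D) [𝒟.metric.HasLeviCivita] :
    𝒟.metric.IsFutureSet 𝒟.timeOrientation 𝒟.blackHoleRegion :=
  LorentzianMetric.chronologicalFuture_blackHoleRegion_subset

end DataEmbedding

/-! ### The relative notions of `EventHorizonArea.lean` at `U = completeNullRayRegion` -/

namespace CauchyDevelopment

variable {n : ℕ} {X : Type u} [TopologicalSpace X] [ChartedSpace (EuclideanSpace ℝ (Fin n)) X]
  [IsManifold (𝓡 n) ∞ X] [ConnectedSpace X] {D : InitialDataSet (𝓡 n) X}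

/-- The relative event horizons of `EventHorizonArea.lean` (`eventHorizon`) and of
`RedShiftedHorizon.lean` (`eventHorizonOf`) are the same set `∂I⁻(U) ∩ J⁺(ι X)`
(definitionally). [folklore] -/
theorem eventHorizon_eq_eventHorizonOf (𝒟 : CauchyDevelopment D) (U : Set 𝒟.carrier) :
    𝒟.eventHorizon U = 𝒟.eventHorizonOf U :=
  rfl

/-- **At `U = completeNullRayRegion` the relative event horizon is the intrinsic one to the
future of the data**: `𝒟.eventHorizon 𝒟.completeNullRayRegion = 𝓗⁺ ∩ J⁺(ι X)`
(`I⁻(completeNullRayRegion) = visibleRegion`). Hawking–Ellis 1973, §9.2, p. 312.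
[cite: HawkingEllis1973, §9.2, p. 312] -/
theorem eventHorizon_completeNullRayRegion (𝒟 : CauchyDevelopment D) [𝒟.metric.HasLeviCivita] :
    𝒟.eventHorizon 𝒟.completeNullRayRegion =
      𝒟.futureEventHorizon ∩ 𝒟.metric.causalFuture 𝒟.timeOrientation (range 𝒟.embed) := by
  rw [eventHorizon_eq_eventHorizonOf]
  exact (𝒟.futureEventHorizon_inter_causalFuture).symm

/-- **At `U = completeNullRayRegion` the relative black-hole region is the intrinsic one to the
future of the data**: `𝒟.blackHoleRegion 𝒟.completeNullRayRegion = 𝓑 ∩ J⁺(ι X)` — Hawking–Ellis'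
black holes on the slices to the future of the data, `ℬ(τ) = 𝒮(τ) − J⁻(𝓘⁺)` (1973, §9.2,
p. 315). (For `𝒟 : CauchyDevelopment D`, `𝒟.blackHoleRegion` is this two-argument relative
notion; the absolute region of `EventHorizon.lean` is `𝒟.toDataEmbedding.blackHoleRegion`.)
[cite: HawkingEllis1973, §9.2, p. 315] -/
theorem blackHoleRegion_completeNullRayRegion (𝒟 : CauchyDevelopment D) [𝒟.metric.HasLeviCivita] :
    𝒟.blackHoleRegion 𝒟.completeNullRayRegion =
      𝒟.toDataEmbedding.blackHoleRegion ∩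
        𝒟.metric.causalFuture 𝒟.timeOrientation (range 𝒟.embed) := by
  rw [blackHoleRegion, DataEmbedding.chronologicalPast_completeNullRayRegion,
    DataEmbedding.blackHoleRegion_eq_compl, sdiff_eq, inter_comm]

/-- The intrinsic horizon cut by a set to the future of the data is the corresponding cut of the
relative horizon `𝒟.eventHorizon 𝒟.completeNullRayRegion`. [folklore] -/
theorem horizonCut_eq_eventHorizon_inter (𝒟 : CauchyDevelopment D) [𝒟.metric.HasLeviCivita]
    {S : Set 𝒟.carrier} (hS : S ⊆ 𝒟.metric.causalFuture 𝒟.timeOrientation (range 𝒟.embed)) :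
    𝒟.horizonCut S = 𝒟.eventHorizon 𝒟.completeNullRayRegion ∩ S := by
  rw [eventHorizon_eq_eventHorizonOf]
  exact 𝒟.horizonCut_eq_eventHorizonOf_inter hS

end CauchyDevelopment

/-! ### The area law for the intrinsic event horizon -/

section AreaLaw

variable {X : Type u} [TopologicalSpace X] [ChartedSpace E3 X] [IsManifold (𝓡 3) ∞ X]
  [ConnectedSpace X] {D : InitialDataSet (𝓡 3) X}

/-- **The area law for the intrinsic future event horizon, leaves with metric data** (from the
named fact `ChruscielEtAl2001_areaTheorem`, hypothesis `hAT`). Let `𝒟` be a data embedding /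
Cauchy development of `3`-dimensional data with intrinsic horizon `𝓗⁺ = 𝒟.futureEventHorizon`,
and assume the three hypotheses of Chruściel–Delay–Galloway–Howard 2001, Thm. 1.1 (b) that are
not automatic: `𝓗⁺` is an embedded topological hypersurface, it is ruled by future-complete null
generators, and the null energy condition holds on it (closedness and achronality of `𝓗⁺` are
theorems: `isClosed_frontier`, `DataEmbedding.isAchronal_futureEventHorizon`). Then for two smooth
achronal embedded hypersurfaces `σₐ : Lₐ → M` with induced metrics `hₐ = σₐ^* g` and sections
`Sₐ = σₐ(Lₐ) ∩ 𝓗⁺` with `S₁ ⊆ J⁻(S₂)`: `ℌ²_{h₁}(σ₁⁻¹ 𝓗⁺) ≤ ℌ²_{h₂}(σ₂⁻¹ 𝓗⁺)`.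
Chruściel–Delay–Galloway–Howard 2001, Thm. 1.1 (b); Hawking–Ellis 1973, Prop. 9.2.7.
[cite: ChruscielEtAl2001, Thm. 1.1 (b)] -/
theorem DataEmbedding.area_horizonCut_le (hAT : ChruscielEtAl2001_areaTheorem.{u})
    (𝒟 : DataEmbedding D) [𝒟.metric.HasLeviCivita]
    (htop : IsTopologicalSubmanifold 3 𝒟.futureEventHorizon)
    (hgen : 𝒟.toSpacetime.IsRuledByCompleteNullGeodesics 𝒟.futureEventHorizon)
    (hnec : 𝒟.toSpacetime.SatisfiesNullConvergenceOn 𝒟.futureEventHorizon)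
    (L₁ : Type u) [TopologicalSpace L₁] [ChartedSpace E3 L₁] [IsManifold (𝓡 3) ∞ L₁]
    [T2Space L₁] [LocallyCompactSpace L₁] [MeasurableSpace L₁] [BorelSpace L₁]
    (L₂ : Type u) [TopologicalSpace L₂] [ChartedSpace E3 L₂] [IsManifold (𝓡 3) ∞ L₂]
    [T2Space L₂] [LocallyCompactSpace L₂] [MeasurableSpace L₂] [BorelSpace L₂]
    (σ₁ : L₁ → 𝒟.carrier) (σ₂ : L₂ → 𝒟.carrier)
    (h₁ : ContMDiffRiemannianMetric (𝓡 3) ∞ E3 (TangentSpace (𝓡 3) : L₁ → Type _))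
    (h₂ : ContMDiffRiemannianMetric (𝓡 3) ∞ E3 (TangentSpace (𝓡 3) : L₂ → Type _))
    (he₁ : Manifold.IsSmoothEmbedding (𝓡 3) (𝓡 4) ∞ σ₁)
    (he₂ : Manifold.IsSmoothEmbedding (𝓡 3) (𝓡 4) ∞ σ₂)
    (hind₁ : ∀ y, pullbackBilin (I := 𝓡 4) (I' := 𝓡 3) σ₁ 𝒟.metric.val y = h₁.inner y)
    (hind₂ : ∀ y, pullbackBilin (I := 𝓡 4) (I' := 𝓡 3) σ₂ 𝒟.metric.val y = h₂.inner y)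
    (ha₁ : 𝒟.metric.IsAchronal 𝒟.timeOrientation (range σ₁))
    (ha₂ : 𝒟.metric.IsAchronal 𝒟.timeOrientation (range σ₂))
    (hJ : range σ₁ ∩ 𝒟.futureEventHorizon ⊆
      𝒟.metric.causalPast 𝒟.timeOrientation (range σ₂ ∩ 𝒟.futureEventHorizon)) :
    area h₁ (σ₁ ⁻¹' 𝒟.futureEventHorizon) ≤ area h₂ (σ₂ ⁻¹' 𝒟.futureEventHorizon) :=
  hAT 𝒟.toSpacetime 𝒟.futureEventHorizon 𝒟.isClosed_futureEventHorizon
    𝒟.isAchronal_futureEventHorizon htop hgen hnec L₁ L₂ σ₁ σ₂ h₁ h₂ he₁ he₂ hind₁ hind₂ ha₁ ha₂ hJ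

/-- **The area law for the intrinsic future event horizon, leaves as spacelike immersions**: as
`DataEmbedding.area_horizonCut_le`, for smooth achronal embedded spacelike hypersurfaces
`fₐ : Nₐ → M` (`IsSpacelikeImmersion`, smoothness fact `hpbₐ`) and the induced-metric areas
`𝒟.horizonCutArea fₐ` of `EventHorizon.lean`: if `f₁(N₁) ∩ 𝓗⁺ ⊆ J⁻(f₂(N₂) ∩ 𝓗⁺)` then
`𝒟.horizonCutArea f₁ ≤ 𝒟.horizonCutArea f₂`. Chruściel–Delay–Galloway–Howard 2001, Thm. 1.1 (b).
[cite: ChruscielEtAl2001, Thm. 1.1 (b)] -/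
theorem DataEmbedding.horizonCutArea_le (hAT : ChruscielEtAl2001_areaTheorem.{u})
    (𝒟 : DataEmbedding D) [𝒟.metric.HasLeviCivita]
    (htop : IsTopologicalSubmanifold 3 𝒟.futureEventHorizon)
    (hgen : 𝒟.toSpacetime.IsRuledByCompleteNullGeodesics 𝒟.futureEventHorizon)
    (hnec : 𝒟.toSpacetime.SatisfiesNullConvergenceOn 𝒟.futureEventHorizon)
    {N₁ N₂ : Type u} [TopologicalSpace N₁] [ChartedSpace E3 N₁] [IsManifold (𝓡 3) ∞ N₁]
    [T2Space N₁] [LocallyCompactSpace N₁] [MeasurableSpace N₁] [BorelSpace N₁]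
    [TopologicalSpace N₂] [ChartedSpace E3 N₂] [IsManifold (𝓡 3) ∞ N₂]
    [T2Space N₂] [LocallyCompactSpace N₂] [MeasurableSpace N₂] [BorelSpace N₂]
    {f₁ : N₁ → 𝒟.carrier} {f₂ : N₂ → 𝒟.carrier}
    (hpb₁ : PseudoRiemannianMetric.contMDiff_pullbackBilin (𝓡 4) 𝒟.carrier (𝓡 3) N₁ ∞)
    (hpb₂ : PseudoRiemannianMetric.contMDiff_pullbackBilin (𝓡 4) 𝒟.carrier (𝓡 3) N₂ ∞)
    (hf₁ : 𝒟.metric.IsSpacelikeImmersion (𝓡 3) f₁) (hf₂ : 𝒟.metric.IsSpacelikeImmersion (𝓡 3) f₂)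
    (he₁ : Manifold.IsSmoothEmbedding (𝓡 3) (𝓡 4) ∞ f₁)
    (he₂ : Manifold.IsSmoothEmbedding (𝓡 3) (𝓡 4) ∞ f₂)
    (ha₁ : 𝒟.metric.IsAchronal 𝒟.timeOrientation (range f₁))
    (ha₂ : 𝒟.metric.IsAchronal 𝒟.timeOrientation (range f₂))
    (hJ : range f₁ ∩ 𝒟.futureEventHorizon ⊆
      𝒟.metric.causalPast 𝒟.timeOrientation (range f₂ ∩ 𝒟.futureEventHorizon)) :
    𝒟.horizonCutArea f₁ hpb₁ hf₁ ≤ 𝒟.horizonCutArea f₂ hpb₂ hf₂ :=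
  DataEmbedding.area_horizonCut_le hAT 𝒟 htop hgen hnec N₁ N₂ f₁ f₂
    (𝒟.metric.inducedRiemannianMetric f₁ hpb₁ hf₁) (𝒟.metric.inducedRiemannianMetric f₂ hpb₂ hf₂)
    he₁ he₂ (fun _ ↦ rfl) (fun _ ↦ rfl) ha₁ ha₂ hJ

/-- **The area law for the intrinsic event horizon of a vacuum Cauchy development**: as
`DataEmbedding.horizonCutArea_le`, with the null energy condition on `𝓗⁺` discharged by the
vacuum equations (`Ric = 0`, `VacuumCauchyDevelopment.satisfiesNullConvergenceOn`); the remaining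
hypotheses on `𝓗⁺` are the topological-hypersurface property and the ruling by future-complete
null generators. Chruściel–Delay–Galloway–Howard 2001, Thm. 1.1 (b); Hawking–Ellis 1973,
Prop. 9.2.7. [cite: ChruscielEtAl2001, Thm. 1.1 (b)] -/
theorem VacuumCauchyDevelopment.horizonCutArea_le (hAT : ChruscielEtAl2001_areaTheorem.{u})
    (𝒟 : VacuumCauchyDevelopment D) [𝒟.metric.HasLeviCivita]
    (htop : IsTopologicalSubmanifold 3 𝒟.futureEventHorizon)
    (hgen : 𝒟.toSpacetime.IsRuledByCompleteNullGeodesics 𝒟.futureEventHorizon)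
    {N₁ N₂ : Type u} [TopologicalSpace N₁] [ChartedSpace E3 N₁] [IsManifold (𝓡 3) ∞ N₁]
    [T2Space N₁] [LocallyCompactSpace N₁] [MeasurableSpace N₁] [BorelSpace N₁]
    [TopologicalSpace N₂] [ChartedSpace E3 N₂] [IsManifold (𝓡 3) ∞ N₂]
    [T2Space N₂] [LocallyCompactSpace N₂] [MeasurableSpace N₂] [BorelSpace N₂]
    {f₁ : N₁ → 𝒟.carrier} {f₂ : N₂ → 𝒟.carrier}
    (hpb₁ : PseudoRiemannianMetric.contMDiff_pullbackBilin (𝓡 4) 𝒟.carrier (𝓡 3) N₁ ∞)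
    (hpb₂ : PseudoRiemannianMetric.contMDiff_pullbackBilin (𝓡 4) 𝒟.carrier (𝓡 3) N₂ ∞)
    (hf₁ : 𝒟.metric.IsSpacelikeImmersion (𝓡 3) f₁) (hf₂ : 𝒟.metric.IsSpacelikeImmersion (𝓡 3) f₂)
    (he₁ : Manifold.IsSmoothEmbedding (𝓡 3) (𝓡 4) ∞ f₁)
    (he₂ : Manifold.IsSmoothEmbedding (𝓡 3) (𝓡 4) ∞ f₂)
    (ha₁ : 𝒟.metric.IsAchronal 𝒟.timeOrientation (range f₁))
    (ha₂ : 𝒟.metric.IsAchronal 𝒟.timeOrientation (range f₂))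
    (hJ : range f₁ ∩ 𝒟.futureEventHorizon ⊆
      𝒟.metric.causalPast 𝒟.timeOrientation (range f₂ ∩ 𝒟.futureEventHorizon)) :
    𝒟.horizonCutArea f₁ hpb₁ hf₁ ≤ 𝒟.horizonCutArea f₂ hpb₂ hf₂ :=
  DataEmbedding.horizonCutArea_le hAT 𝒟.toDataEmbedding htop hgen
    (𝒟.satisfiesNullConvergenceOn _) hpb₁ hpb₂ hf₁ hf₂ he₁ he₂ ha₁ ha₂ hJ

/-- **Monotonicity of the horizon area along an advanced-time foliation of the intrinsic event
horizon** `𝓗⁺ ∩ J⁺(ι X) = 𝒟.eventHorizon 𝒟.completeNullRayRegion`: from the named fact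
`ChruscielEtAl2001_areaTheorem` (`hAT`) via `EventHorizonArea.monotone_horizonArea`, with the
achronality hypothesis of that bridge discharged (`∂I⁻(completeNullRayRegion) = 𝓗⁺` is achronal,
`DataEmbedding.isAchronal_futureEventHorizon`). Chruściel–Delay–Galloway–Howard 2001, Thm. 1.1 (b);
Hawking–Ellis 1973, Prop. 9.2.7. [cite: ChruscielEtAl2001, Thm. 1.1 (b)] -/
theorem EventHorizonArea.monotone_horizonArea_completeNullRayRegion
    (hAT : ChruscielEtAl2001_areaTheorem.{u}) {𝒟 : CauchyDevelopment D} [𝒟.metric.HasLeviCivita]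
    (A : EventHorizonArea 𝒟 𝒟.completeNullRayRegion)
    (htop : IsTopologicalSubmanifold 3 𝒟.futureEventHorizon)
    (hgen : 𝒟.toSpacetime.IsRuledByCompleteNullGeodesics 𝒟.futureEventHorizon)
    (hnec : 𝒟.toSpacetime.SatisfiesNullConvergenceOn 𝒟.futureEventHorizon) :
    Monotone A.horizonArea := by
  refine A.monotone_horizonArea hAT ?_ ?_ ?_ ?_ <;>
    rw [DataEmbedding.chronologicalPast_completeNullRayRegion]
  · exact 𝒟.isAchronal_futureEventHorizon
  · exact htop
  · exact hgen
  · exact hnec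

/-- The vacuum form of `EventHorizonArea.monotone_horizonArea_completeNullRayRegion`: along any
advanced-time foliation of `𝓗⁺ ∩ J⁺(ι X)` of a vacuum Cauchy development the horizon area is
monotone, provided `𝓗⁺` is an embedded topological hypersurface ruled by future-complete null
generators (achronality, closedness and the null energy condition being theorems).
Chruściel–Delay–Galloway–Howard 2001, Thm. 1.1 (b); Hawking–Ellis 1973, Prop. 9.2.7.
[cite: ChruscielEtAl2001, Thm. 1.1 (b)] -/
theorem VacuumCauchyDevelopment.monotone_horizonArea_completeNullRayRegion
    (hAT : ChruscielEtAl2001_areaTheorem.{u}) (𝒟 : VacuumCauchyDevelopment D)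
    [𝒟.metric.HasLeviCivita] (A : EventHorizonArea 𝒟.toCauchyDevelopment 𝒟.completeNullRayRegion)
    (htop : IsTopologicalSubmanifold 3 𝒟.futureEventHorizon)
    (hgen : 𝒟.toSpacetime.IsRuledByCompleteNullGeodesics 𝒟.futureEventHorizon) :
    Monotone A.horizonArea :=
  A.monotone_horizonArea_completeNullRayRegion hAT htop hgen (𝒟.satisfiesNullConvergenceOn _)

/-! ### Discharging the hypersurface hypothesis by Hawking–Ellis, Prop. 6.3.1 -/

/-- **The intrinsic future event horizon is an embedded topological hypersurface** (from the
named fact `HawkingEllis1973_achronalBoundary`, hypothesis `h631`): `𝓗⁺ = ∂𝓑` is the boundary of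
the future set `𝓑 = 𝒟.blackHoleRegion`, hence an achronal boundary — a closed, achronal, embedded
topological `3`-submanifold of the `4`-dimensional spacetime. Hawking–Ellis 1973, Prop. 6.3.1 and
§9.2, p. 312 ("the event horizon is an achronal boundary").
[cite: HawkingEllis1973, §6.3, Prop. 6.3.1 (p. 187)] -/
theorem DataEmbedding.isTopologicalSubmanifold_futureEventHorizon
    (h631 : HawkingEllis1973_achronalBoundary.{u}) (𝒟 : DataEmbedding D) [𝒟.metric.HasLeviCivita] :
    IsTopologicalSubmanifold 3 𝒟.futureEventHorizon := by
  rw [DataEmbedding.futureEventHorizon_eq_frontier_blackHoleRegion]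
  exact (h631 𝒟.toSpacetime 𝒟.blackHoleRegion 𝒟.isFutureSet_blackHoleRegion).2.2

/-- **The area law for the intrinsic event horizon, hypersurface hypothesis discharged**: as
`DataEmbedding.horizonCutArea_le`, from the two named facts `ChruscielEtAl2001_areaTheorem` (`hAT`)
and `HawkingEllis1973_achronalBoundary` (`h631`); the hypotheses on `𝓗⁺` that remain are the
ruling by future-complete null generators and the null energy condition on `𝓗⁺`.
Chruściel–Delay–Galloway–Howard 2001, Thm. 1.1 (b); Hawking–Ellis 1973, Prop. 6.3.1, Prop. 9.2.7.
[cite: ChruscielEtAl2001, Thm. 1.1 (b)] -/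
theorem DataEmbedding.horizonCutArea_le_of_achronalBoundary
    (hAT : ChruscielEtAl2001_areaTheorem.{u}) (h631 : HawkingEllis1973_achronalBoundary.{u})
    (𝒟 : DataEmbedding D) [𝒟.metric.HasLeviCivita]
    (hgen : 𝒟.toSpacetime.IsRuledByCompleteNullGeodesics 𝒟.futureEventHorizon)
    (hnec : 𝒟.toSpacetime.SatisfiesNullConvergenceOn 𝒟.futureEventHorizon)
    {N₁ N₂ : Type u} [TopologicalSpace N₁] [ChartedSpace E3 N₁] [IsManifold (𝓡 3) ∞ N₁]
    [T2Space N₁] [LocallyCompactSpace N₁] [MeasurableSpace N₁] [BorelSpace N₁]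
    [TopologicalSpace N₂] [ChartedSpace E3 N₂] [IsManifold (𝓡 3) ∞ N₂]
    [T2Space N₂] [LocallyCompactSpace N₂] [MeasurableSpace N₂] [BorelSpace N₂]
    {f₁ : N₁ → 𝒟.carrier} {f₂ : N₂ → 𝒟.carrier}
    (hpb₁ : PseudoRiemannianMetric.contMDiff_pullbackBilin (𝓡 4) 𝒟.carrier (𝓡 3) N₁ ∞)
    (hpb₂ : PseudoRiemannianMetric.contMDiff_pullbackBilin (𝓡 4) 𝒟.carrier (𝓡 3) N₂ ∞)
    (hf₁ : 𝒟.metric.IsSpacelikeImmersion (𝓡 3) f₁) (hf₂ : 𝒟.metric.IsSpacelikeImmersion (𝓡 3) f₂)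
    (he₁ : Manifold.IsSmoothEmbedding (𝓡 3) (𝓡 4) ∞ f₁)
    (he₂ : Manifold.IsSmoothEmbedding (𝓡 3) (𝓡 4) ∞ f₂)
    (ha₁ : 𝒟.metric.IsAchronal 𝒟.timeOrientation (range f₁))
    (ha₂ : 𝒟.metric.IsAchronal 𝒟.timeOrientation (range f₂))
    (hJ : range f₁ ∩ 𝒟.futureEventHorizon ⊆
      𝒟.metric.causalPast 𝒟.timeOrientation (range f₂ ∩ 𝒟.futureEventHorizon)) :
    𝒟.horizonCutArea f₁ hpb₁ hf₁ ≤ 𝒟.horizonCutArea f₂ hpb₂ hf₂ :=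
  DataEmbedding.horizonCutArea_le hAT 𝒟 (𝒟.isTopologicalSubmanifold_futureEventHorizon h631) hgen
    hnec hpb₁ hpb₂ hf₁ hf₂ he₁ he₂ ha₁ ha₂ hJ

/-- **Hawking's area theorem for the intrinsic event horizon of a vacuum Cauchy development**,
in the differentiability-free form: from the named facts `ChruscielEtAl2001_areaTheorem` (`hAT`)
and `HawkingEllis1973_achronalBoundary` (`h631`), if the generators of the future event horizon
`𝓗⁺` of the vacuum Cauchy development `𝒟` are future complete (`IsRuledByCompleteNullGeodesics`,
CDGH hypothesis (b)), then for two smooth achronal embedded spacelike hypersurfaces `f₁, f₂` with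
`f₁(N₁) ∩ 𝓗⁺ ⊆ J⁻(f₂(N₂) ∩ 𝓗⁺)` the horizon cut areas satisfy
`𝒟.horizonCutArea f₁ ≤ 𝒟.horizonCutArea f₂` (closedness, achronality and the hypersurface property
of `𝓗⁺`, and the null energy condition, being theorems here). Hawking–Ellis 1973, Prop. 9.2.7;
Chruściel–Delay–Galloway–Howard 2001, Thm. 1.1 (b). [cite: ChruscielEtAl2001, Thm. 1.1 (b)] -/
theorem VacuumCauchyDevelopment.horizonCutArea_le_of_achronalBoundary
    (hAT : ChruscielEtAl2001_areaTheorem.{u}) (h631 : HawkingEllis1973_achronalBoundary.{u})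
    (𝒟 : VacuumCauchyDevelopment D) [𝒟.metric.HasLeviCivita]
    (hgen : 𝒟.toSpacetime.IsRuledByCompleteNullGeodesics 𝒟.futureEventHorizon)
    {N₁ N₂ : Type u} [TopologicalSpace N₁] [ChartedSpace E3 N₁] [IsManifold (𝓡 3) ∞ N₁]
    [T2Space N₁] [LocallyCompactSpace N₁] [MeasurableSpace N₁] [BorelSpace N₁]
    [TopologicalSpace N₂] [ChartedSpace E3 N₂] [IsManifold (𝓡 3) ∞ N₂]
    [T2Space N₂] [LocallyCompactSpace N₂] [MeasurableSpace N₂] [BorelSpace N₂]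
    {f₁ : N₁ → 𝒟.carrier} {f₂ : N₂ → 𝒟.carrier}
    (hpb₁ : PseudoRiemannianMetric.contMDiff_pullbackBilin (𝓡 4) 𝒟.carrier (𝓡 3) N₁ ∞)
    (hpb₂ : PseudoRiemannianMetric.contMDiff_pullbackBilin (𝓡 4) 𝒟.carrier (𝓡 3) N₂ ∞)
    (hf₁ : 𝒟.metric.IsSpacelikeImmersion (𝓡 3) f₁) (hf₂ : 𝒟.metric.IsSpacelikeImmersion (𝓡 3) f₂)
    (he₁ : Manifold.IsSmoothEmbedding (𝓡 3) (𝓡 4) ∞ f₁)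
    (he₂ : Manifold.IsSmoothEmbedding (𝓡 3) (𝓡 4) ∞ f₂)
    (ha₁ : 𝒟.metric.IsAchronal 𝒟.timeOrientation (range f₁))
    (ha₂ : 𝒟.metric.IsAchronal 𝒟.timeOrientation (range f₂))
    (hJ : range f₁ ∩ 𝒟.futureEventHorizon ⊆
      𝒟.metric.causalPast 𝒟.timeOrientation (range f₂ ∩ 𝒟.futureEventHorizon)) :
    𝒟.horizonCutArea f₁ hpb₁ hf₁ ≤ 𝒟.horizonCutArea f₂ hpb₂ hf₂ :=
  DataEmbedding.horizonCutArea_le_of_achronalBoundary hAT h631 𝒟.toDataEmbedding hgen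
    (𝒟.satisfiesNullConvergenceOn _) hpb₁ hpb₂ hf₁ hf₂ he₁ he₂ ha₁ ha₂ hJ

/-- **Hawking's area theorem along an advanced-time foliation of the intrinsic event horizon of
a vacuum Cauchy development**: from the two named facts, if the generators of `𝓗⁺` are future
complete then `v ↦ A.horizonArea v` is monotone for every advanced-time foliation `A` of
`𝓗⁺ ∩ J⁺(ι X) = 𝒟.eventHorizon 𝒟.completeNullRayRegion`. Hawking–Ellis 1973, Prop. 9.2.7 ("the
area of the boundary of a black hole cannot decrease with time"); Chruściel–Delay–Galloway–Howard
2001, Thm. 1.1 (b). [cite: ChruscielEtAl2001, Thm. 1.1 (b)] -/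
theorem VacuumCauchyDevelopment.monotone_horizonArea_of_achronalBoundary
    (hAT : ChruscielEtAl2001_areaTheorem.{u}) (h631 : HawkingEllis1973_achronalBoundary.{u})
    (𝒟 : VacuumCauchyDevelopment D) [𝒟.metric.HasLeviCivita]
    (A : EventHorizonArea 𝒟.toCauchyDevelopment 𝒟.completeNullRayRegion)
    (hgen : 𝒟.toSpacetime.IsRuledByCompleteNullGeodesics 𝒟.futureEventHorizon) :
    Monotone A.horizonArea :=
  𝒟.monotone_horizonArea_completeNullRayRegion hAT A
    (DataEmbedding.isTopologicalSubmanifold_futureEventHorizon h631 𝒟.toDataEmbedding) hgen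

end AreaLaw

end Literature.Geometry.Lorentzian

end
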